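/-
Copyright: lit-balaban cell, Phase-2 proof seat p30 (gen 35).  Statement-level skeleton of a published paper; no proof claims beyond
what the kernel checks below.
-/
import Literature.MathematicalPhysics.QuantumFieldTheory.BalabanImbrieJaffe1984to88.BIJ88SmallBlockFields332Ubar
import Literature.MathematicalPhysics.QuantumFieldTheory.BalabanImbrieJaffe1984to88.BIJ88ChargePowerLogScale
import Literature.MathematicalPhysics.QuantumFieldTheory.BalabanImbrieJaffe1984to88.BIJ88RestrictionsVanish308
import Literature.MathematicalPhysics.QuantumFieldTheory.BalabanImbrieJaffe1984to88.BIJ88Eq5613Summary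

/-!
# `BalabanImbrieJaffe1984to88.BIJ88SmallBlockFields332SmallCharge` — T. Bałaban, J. Imbrie, A. Jaffe, *Effective action and cluster
properties of the abelian Higgs model*, Commun. Math. Phys. **114** (1988) 257–315 [BalabanImbrieJaffe1988], p. 270 **(3.32)** *"|(D_{ū₁}ψ)(b′)|
≦ cp(e₀), b′ ∈ Λ₀^{(0)′*}"* with the logarithmic scale **(2.33)** p. 263 *"p(e_k) = |log e_k⁻¹|^p, p = O(1)"* and the paper's two standing
smallness sentences, p. 266 [PDF 10] *"since e²/λ = O(1) we have also e_k²/λ_k = O(1) by (2.2)"* and p. 273 [PDF 17] *"with β > 0 small and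
e ≪ 1"*: **THE THREE `e₀`-REGIMES OF THE (3.32) THIRD-CLAUSE THEOREMS DISCHARGED FOR SMALL CHARGE** — the regime hypotheses
`17d²L²e₀p(e₀) < π`, `2·17d²L²e₀p(e₀) ≤ λ₀^{1/4}`, `L·e₀·C·p(e₀) ≤ λ₀^{1/4}` of p30 gen 34's `BIJ88SmallBlockFields332Ubar.smallBlock332_u1bar_byName` /
`smallBlock332_u1bgBar_byName` HOLD once `0 < e₀ ≤ ē(d, L, C, c₀, p)` and `e₀² ≤ c₀λ₀`, with `p(e₀) = pLog p e₀` (r18's (2.33)) — PROVED, with an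
explicit threshold.

statement-level skeleton of published theorems with citation tags; proofs where landed; nothing here is a claim about the Yang–Mills mass gap

PDF held: `paper:balaban1988-cmp114-bij-abelian-higgs-effective-action` (journal page = PDF page + 256); p. 266 [PDF 10] read this session from
the text layer (`lit read … --pages 10-11`: *"and since e2/λ = 0(1) we have also ek/λk = 0(1) by (2.2)"*), p. 270 / p. 273 as quoted in the two
imported files.

CITATION HEADER (lean-in-tree rule).  Part of the lit-balaban TYPED SKELETON (HOME `run/shared/lean/pub/lit-balaban/`), Phase 2, seat p30
gen 35 (unit `lit-balaban-p30-g35`; TAKING #2 HOME/STATUS.md 2026-08-23T17:19:00Z).  LOCATED MEMBER (zero head weight) of row **C2.Eq3.32**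
(owner r18; ⟦v2.103 SCOPE⟧ *"hypotheses left = located margins + three e₀-regimes with one C(d,L)"*): the three `e₀`-regimes are replaced by
the paper's standing smallness of the charge.  Support lemmas: p02's `BIJ88ChargePowerLogScale.rpow_mul_log_inv_rpow_le` (`e^θ(log e⁻¹)^q ≤
(2q/θ)^q e^{θ/2}`) and `small_of_le_threshold` BY NAME; r18's `BIJ88Sect2Statements.pLog` BY NAME; `pLog_nonneg` / `pLog_eq_rpow` from
`BIJ88RestrictionsVanish308` / `BIJ88Eq5613Summary` BY NAME (v1 of this file restated them — `dedup.landed` bounce of p369848, fixed here).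

WHAT IS PROVED (kernel-checked, 0 `sorry`, standard axioms, theorems only — no definition, no `def … : Prop`).
* §1 (`p(e) ≥ 0` and `p(e) = (log e⁻¹)^p` on `(0,1]` are the tree's `BIJ88RestrictionsVanish308.pLog_nonneg` / `BIJ88Eq5613Summary.pLog_eq_rpow`,
  reused BY NAME) **`mul_pLog_le`** (`e·p(e) ≤ (4p)^p·e^{3/4}` on `(0,1]`, `p > 0`),
  `rpow_quarter_le_of_sq_le` (`e² ≤ c₀λ ⟹ c₀^{−1/4}e^{1/2} ≤ λ^{1/4}`), **`regimes332_of_smallCharge`**: for all `d, L`, `C ≥ 0`, `c₀ > 0`,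
  `p > 0` there is `ē ∈ (0, 1]` — explicitly `ē = min 1 (2C⋆ + 1)^{−4}`, `C⋆ = (17d²L² + (2·17d²L² + L·C)·c₀^{1/4})·(4p)^p` — such that
  `0 < e₀ ≤ ē`, `0 < λ₀`, `e₀² ≤ c₀λ₀` imply the three regimes with `p(e₀) = pLog p e₀`.
* §2 **`smallBlock332_u1bar_smallCharge`** (typing (A′) of the row: gen 34's `smallBlock332_u1bar_byName` with the three regime hypotheses
  REPLACED by `e₀ ≤ ē` and `e₀² ≤ c₀λ₀`; hypotheses left = the located margins, `λ₀ ≤ 1`, and (3.15) = r18's `SmallField315 (pLog p e₀) λ₀ …` BY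
  NAME) and **`smallBlock332_u1bgBar_smallCharge`** (typing (B), `u` in the axial gauge, every `A^{(0)}` tied to `arg(u′)/e₀` by (3.27)).
HONEST SCOPE.  `c₀` (the O(1) of *"e²/λ = O(1)"*) and the exponent `p > 0` of (2.33) are parameters; `ē` depends on `(d, L, c₀, p)` and on the
row's constant `C(d, L)` only, not on the torus, `R`, the fields or the regions.  Nothing else of the two gen-34 theorems changes; no SKELETON
head moves.  The (3.33) scalar-side regimes of p27's `small333_scalar_of_smallField315[_at_u]` admit the same treatment (not done here).
-/

namespace Literature.MathematicalPhysics.QuantumFieldTheory.BalabanImbrieJaffe1984to88.BIJ88SmallBlockFields332SmallCharge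

open Literature.MathematicalPhysics.QuantumFieldTheory.Balaban1983to89
open BIJ88Sect3Statements (U1 toC cfg covD plaqVar fieldStrength starB starP SmallField315 SmallBlock332)
open BIJ85Sect1Model (HiggsField argB)
open BIJ85BlockAveragesTorus (qU qCov)
open BIJ88Sect4Statements (barU)
open BIJ88RT51Background42 (bg42)
open BIJ85Eq453GaugeField (qsstarG)
open BIJ88Sect3Translations (u1bg)
open BIJ88SecondTranslation327Torus (corr327 w327)
open LatticeFieldCalculus (supDist)
open B15DeterminingSets (embIter)
open BIJ88RenormTransf311 (DeltaAx)
open BIJ88Sect2Statements (pLog)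
open BIJ88ChargePowerLogScale (rpow_mul_log_inv_rpow_le small_of_le_threshold)
open BIJ88RestrictionsVanish308 (pLog_nonneg)
open BIJ88Eq5613Summary (pLog_eq_rpow)
open BIJ88SmallBlockFields332Ubar (smallBlock332_u1bar_byName smallBlock332_u1bgBar_byName)
open scoped BigOperators Real
open Finset

noncomputable section

variable {P : Params}

/-! ## §1 The logarithmic scale against the charge: `e·p(e) ≤ (4p)^p e^{3/4}`, and the three regimes for small `e₀` -/

/-- **`e·p(e) ≤ (4p)^p·e^{3/4}` on `(0,1]`** (`p > 0`): p02's kernel `e^{1/2}(log e⁻¹)^p ≤ (4p)^p e^{1/4}` times `e^{1/2}` — the mechanism of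
*"e ≪ 1"* (p. 273) against the logarithmic scale (2.33). [cite: BalabanImbrieJaffe1988, (2.33) p.263] -/
theorem mul_pLog_le {p e : ℝ} (hp : 0 < p) (he : 0 < e) (he1 : e ≤ 1) :
    e * pLog p e ≤ (4 * p) ^ p * e ^ (3 / 4 : ℝ) := by
  have h := rpow_mul_log_inv_rpow_le he he1 (by norm_num : (0 : ℝ) < 1 / 2) hp
  rw [show 2 * p / (1 / 2) = 4 * p by ring, show (1 / 2 : ℝ) / 2 = 1 / 4 by norm_num] at h
  have hsplit : e ^ (1 / 2 : ℝ) * e ^ (1 / 2 : ℝ) = e := by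
    rw [← Real.rpow_add he]; norm_num
  have h34 : e ^ (1 / 2 : ℝ) * e ^ (1 / 4 : ℝ) = e ^ (3 / 4 : ℝ) := by
    rw [← Real.rpow_add he]; norm_num
  rw [pLog_eq_rpow he he1]
  calc e * Real.log e⁻¹ ^ p = e ^ (1 / 2 : ℝ) * (e ^ (1 / 2 : ℝ) * Real.log e⁻¹ ^ p) := by
        rw [← mul_assoc, hsplit]
    _ ≤ e ^ (1 / 2 : ℝ) * ((4 * p) ^ p * e ^ (1 / 4 : ℝ)) := mul_le_mul_of_nonneg_left h (Real.rpow_nonneg he.le _)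
    _ = (4 * p) ^ p * e ^ (3 / 4 : ℝ) := by rw [← h34]; ring

/-- kernel: **`e² ≤ c₀λ` gives `c₀^{−1/4}·e^{1/2} ≤ λ^{1/4}`** (p. 266 *"e²/λ = O(1)"* read with the constant `c₀`).
[cite: BalabanImbrieJaffe1988, (3.9) p.266] -/
theorem rpow_quarter_le_of_sq_le {e lam c₀ : ℝ} (he : 0 < e) (hc₀ : 0 < c₀) (h : e ^ 2 ≤ c₀ * lam) :
    c₀ ^ (-(1 / 4 : ℝ)) * e ^ (1 / 2 : ℝ) ≤ lam ^ (1 / 4 : ℝ) := by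
  have h1 : e ^ 2 / c₀ ≤ lam := by rw [div_le_iff₀ hc₀]; linarith
  have h2 : (e ^ 2 / c₀) ^ (1 / 4 : ℝ) ≤ lam ^ (1 / 4 : ℝ) := Real.rpow_le_rpow (by positivity) h1 (by norm_num)
  have h3 : (e ^ 2 / c₀) ^ (1 / 4 : ℝ) = c₀ ^ (-(1 / 4 : ℝ)) * e ^ (1 / 2 : ℝ) := by
    rw [Real.div_rpow (by positivity) hc₀.le, Real.rpow_neg hc₀.le, div_eq_mul_inv, mul_comm]
    congr 1
    rw [show ((e : ℝ) ^ 2) = e ^ (2 : ℝ) by norm_cast, ← Real.rpow_mul he.le]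
    norm_num
  rw [← h3]
  exact h2

/-- **THE THREE `e₀`-REGIMES OF (3.32)'S THIRD-CLAUSE THEOREMS HOLD FOR SMALL CHARGE**: for every `d, L`, `C ≥ 0`, `c₀ > 0` and `p > 0` there
is `ē ∈ (0, 1]` (explicitly `ē = min 1 (2C⋆ + 1)^{−4}`, `C⋆ = (17d²L² + (2·17d²L² + L·C)·c₀^{1/4})·(4p)^p`) such that `0 < e₀ ≤ ē`, `0 < λ₀` and
`e₀² ≤ c₀λ₀` imply `17d²L²·e₀p(e₀) < π`, `2·17d²L²·e₀p(e₀) ≤ λ₀^{1/4}` and `L·e₀·C·p(e₀) ≤ λ₀^{1/4}` with `p(e₀) = pLog p e₀` — print's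
*"e²/λ = O(1)"* (p. 266) and *"e ≪ 1"* (p. 273). [cite: BalabanImbrieJaffe1988, (3.32) p.270] -/
theorem regimes332_of_smallCharge (d L : ℕ) {C c₀ p : ℝ} (hC : 0 ≤ C) (hc₀ : 0 < c₀) (hp : 0 < p) :
    ∃ ē : ℝ, 0 < ē ∧ ē ≤ 1 ∧ ∀ {e₀ lam₀ : ℝ}, 0 < e₀ → e₀ ≤ ē → 0 < lam₀ → e₀ ^ 2 ≤ c₀ * lam₀ →
      17 * (d : ℝ) ^ 2 * (L : ℝ) ^ 2 * (e₀ * pLog p e₀) < π ∧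
      2 * (17 * (d : ℝ) ^ 2 * (L : ℝ) ^ 2) * (e₀ * pLog p e₀) ≤ lam₀ ^ (1 / 4 : ℝ) ∧
      (L : ℝ) * (e₀ * C * pLog p e₀) ≤ lam₀ ^ (1 / 4 : ℝ) := by
  set K₁ : ℝ := 17 * (d : ℝ) ^ 2 * (L : ℝ) ^ 2 with hK₁
  set K₂ : ℝ := 2 * (17 * (d : ℝ) ^ 2 * (L : ℝ) ^ 2) + (L : ℝ) * C with hK₂
  set M : ℝ := (4 * p) ^ p with hM
  set Cs : ℝ := (K₁ + K₂ * c₀ ^ (1 / 4 : ℝ)) * M with hCs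
  have hK₁0 : 0 ≤ K₁ := by positivity
  have hK₂0 : 0 ≤ K₂ := by positivity
  have hM0 : 0 ≤ M := Real.rpow_nonneg (by positivity) _
  have hc4 : 0 < c₀ ^ (1 / 4 : ℝ) := Real.rpow_pos_of_pos hc₀ _
  have hCs0 : 0 ≤ Cs := by positivity
  have hthr : 0 < (2 * Cs + 1) ^ (-(2 / (1 / 2 : ℝ))) := Real.rpow_pos_of_pos (by linarith) _
  refine ⟨min 1 ((2 * Cs + 1) ^ (-(2 / (1 / 2 : ℝ)))), lt_min one_pos hthr, min_le_left _ _, ?_⟩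
  intro e₀ lam₀ he heē hlam hel
  have he1 : e₀ ≤ 1 := heē.trans (min_le_left _ _)
  have hsmall : Cs * e₀ ^ ((1 / 2 : ℝ) / 2) ≤ 1 / 2 :=
    small_of_le_threshold hCs0 (by norm_num) he (heē.trans (min_le_right _ _))
  rw [show (1 / 2 : ℝ) / 2 = 1 / 4 by norm_num] at hsmall
  have hep : e₀ * pLog p e₀ ≤ M * e₀ ^ (3 / 4 : ℝ) := mul_pLog_le hp he he1
  have he14 : 0 ≤ e₀ ^ (1 / 4 : ℝ) := Real.rpow_nonneg he.le _
  have he12 : 0 ≤ e₀ ^ (1 / 2 : ℝ) := Real.rpow_nonneg he.le _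
  have h34 : e₀ ^ (3 / 4 : ℝ) = e₀ ^ (1 / 4 : ℝ) * e₀ ^ (1 / 2 : ℝ) := by
    rw [← Real.rpow_add he]; norm_num
  have h34le : e₀ ^ (3 / 4 : ℝ) ≤ e₀ ^ (1 / 4 : ℝ) := Real.rpow_le_rpow_of_exponent_ge he he1 (by norm_num)
  have hep0 : 0 ≤ e₀ * pLog p e₀ := mul_nonneg he.le (pLog_nonneg _ _)
  -- the two pieces of `Cs · e₀^{1/4} ≤ ½`
  have hpiece1 : K₁ * M * e₀ ^ (1 / 4 : ℝ) ≤ 1 / 2 := by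
    calc K₁ * M * e₀ ^ (1 / 4 : ℝ) ≤ Cs * e₀ ^ (1 / 4 : ℝ) := by
          apply mul_le_mul_of_nonneg_right _ he14
          rw [hCs]
          nlinarith [mul_nonneg hK₂0 hc4.le]
      _ ≤ 1 / 2 := hsmall
  have hpiece2 : K₂ * M * e₀ ^ (1 / 4 : ℝ) * c₀ ^ (1 / 4 : ℝ) ≤ 1 := by
    calc K₂ * M * e₀ ^ (1 / 4 : ℝ) * c₀ ^ (1 / 4 : ℝ) = K₂ * c₀ ^ (1 / 4 : ℝ) * M * e₀ ^ (1 / 4 : ℝ) := by ring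
      _ ≤ Cs * e₀ ^ (1 / 4 : ℝ) := by
          apply mul_le_mul_of_nonneg_right _ he14
          rw [hCs]
          nlinarith [mul_nonneg hK₁0 hM0]
      _ ≤ 1 := hsmall.trans (by norm_num)
  -- λ₀^{1/4} ≥ c₀^{-1/4} e₀^{1/2}
  have hlam4 := rpow_quarter_le_of_sq_le he hc₀ hel
  have hK₂bound : K₂ * (e₀ * pLog p e₀) ≤ lam₀ ^ (1 / 4 : ℝ) := by
    have hcinv : c₀ ^ (-(1 / 4 : ℝ)) = (c₀ ^ (1 / 4 : ℝ))⁻¹ := Real.rpow_neg hc₀.le _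
    calc K₂ * (e₀ * pLog p e₀) ≤ K₂ * (M * e₀ ^ (3 / 4 : ℝ)) := mul_le_mul_of_nonneg_left hep hK₂0
      _ = (K₂ * M * e₀ ^ (1 / 4 : ℝ) * c₀ ^ (1 / 4 : ℝ)) * (c₀ ^ (-(1 / 4 : ℝ)) * e₀ ^ (1 / 2 : ℝ)) := by
          rw [h34, hcinv]; field_simp
      _ ≤ 1 * (c₀ ^ (-(1 / 4 : ℝ)) * e₀ ^ (1 / 2 : ℝ)) :=
          mul_le_mul_of_nonneg_right hpiece2 (mul_nonneg (Real.rpow_nonneg hc₀.le _) he12)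
      _ ≤ lam₀ ^ (1 / 4 : ℝ) := by rw [one_mul]; exact hlam4
  refine ⟨?_, ?_, ?_⟩
  · -- (R1): `K₁ e₀ p(e₀) ≤ K₁ M e₀^{3/4} ≤ K₁ M e₀^{1/4} ≤ ½ < π`
    calc K₁ * (e₀ * pLog p e₀) ≤ K₁ * (M * e₀ ^ (3 / 4 : ℝ)) := mul_le_mul_of_nonneg_left hep hK₁0
      _ ≤ K₁ * (M * e₀ ^ (1 / 4 : ℝ)) := mul_le_mul_of_nonneg_left (mul_le_mul_of_nonneg_left h34le hM0) hK₁0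
      _ = K₁ * M * e₀ ^ (1 / 4 : ℝ) := by ring
      _ ≤ 1 / 2 := hpiece1
      _ < π := by linarith [Real.pi_gt_three]
  · -- (R2): `2·17d²L² ≤ K₂`
    calc 2 * (17 * (d : ℝ) ^ 2 * (L : ℝ) ^ 2) * (e₀ * pLog p e₀) ≤ K₂ * (e₀ * pLog p e₀) := by
          apply mul_le_mul_of_nonneg_right _ hep0
          rw [hK₂]
          nlinarith [Nat.cast_nonneg (α := ℝ) L]
      _ ≤ lam₀ ^ (1 / 4 : ℝ) := hK₂bound
  · -- (R3): `L·C ≤ K₂`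
    calc (L : ℝ) * (e₀ * C * pLog p e₀) = (L : ℝ) * C * (e₀ * pLog p e₀) := by ring
      _ ≤ K₂ * (e₀ * pLog p e₀) := by
          apply mul_le_mul_of_nonneg_right _ hep0
          rw [hK₂]
          nlinarith [hK₁0]
      _ ≤ lam₀ ^ (1 / 4 : ℝ) := hK₂bound

/-! ## §2 The (3.32) third-clause theorems of gen 34 with the regimes replaced by the smallness of the charge -/

/-- **(3.15) ⟹ (3.32) AT PRINT'S `ū₁`, EVERY ANALYTIC INPUT DISCHARGED BY NAME, FOR SMALL CHARGE** (typing (A′)): for `d ≥ 2`, `L ≥ 1`,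
`c₀ > 0`, `p > 0` THERE IS `ē > 0` (on `(d, L, c₀, p)` only) such that on every torus of the series with `P.d = d`, `P.L = L`, `1 ≤ m + K`,
every radius `R`, every `U(1)` field `u` (any gauge), every charge `0 < e₀ ≤ ē` and quartic coupling `0 < λ₀ ≤ 1` with **`e₀² ≤ c₀λ₀`**
(p. 266 *"e²/λ = O(1)"*, p. 273 *"e ≪ 1"*), every fine region `Λ` and coarse regions `Λ′`, `Λ₀′` with the LOCATED MARGINS of gen 34's
`smallBlock332_u1bar_byName` (verbatim), every `ψ, φ`, `0 ≤ c′ ≤ 1`, and (3.15) at the objects of record with `p(e₀) = pLog p e₀` (r18's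
`SmallField315` BY NAME): `SmallBlock332 (2·17d²L²) e₀ p(e₀) λ₀ Λ′ v(∂·) ψ (D_{ū₁}ψ)` at `ū₁ = barU 1 (bg42 1 (w327 hd R L e₀ Λ₄*) (Qu))` for
every bond set `Λ₄*` — gen 34's theorem with its three `e₀`-regimes supplied by §1. [cite: BalabanImbrieJaffe1988, (3.32) p.270] -/
theorem smallBlock332_u1bar_smallCharge (d L : ℕ) (hd : 2 ≤ d) (hL : 1 ≤ L) {c₀ p : ℝ} (hc₀ : 0 < c₀) (hp : 0 < p) :
    ∃ ē : ℝ, 0 < ē ∧ ∀ (P : Params), P.d = d → P.L = L → ∀ (h1 : 1 ≤ P.m + P.K) (hd' : 2 ≤ P.d) (R : ℝ) (U : GaugeField P 0 U1)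
      {e₀ lam₀ : ℝ}, 0 < e₀ → e₀ ≤ ē → 0 < lam₀ → lam₀ ≤ 1 → e₀ ^ 2 ≤ c₀ * lam₀ →
      ∀ {Λ : Finset (Balaban1983to89.Site P 0)} {Λ' Λ₀' : Finset (Balaban1983to89.Site P 1)},
      (∀ x : Balaban1983to89.Site P 0, blockOf x ∈ Λ' → x ∈ Λ) →
      (∀ p : Balaban1983to89.Plaq P 0, blockOf p.src ∈ Λ' → p ∈ starP Λ) →
      (∀ q ∈ starP Λ₀', ∀ p : Balaban1983to89.Plaq P 0, blockOf p.src = q.src ∨ blockOf p.src = q.src.shift q.μ ∨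
        blockOf p.src = q.src.shift q.ν ∨ blockOf p.src = (q.src.shift q.μ).shift q.ν → p ∈ starP Λ) →
      (∀ b' ∈ starB Λ', ∀ s < P.L, ∀ x : Balaban1983to89.Site P 0,
        (supDist (LatticeFieldCalculus.runSite (embIter 1 b'.src) b'.dir s) x : ℝ) ≤ R + 4 * P.L + 1 →
          ∀ q : Balaban1983to89.Plaq P 1, q.src = blockOf x → q ∈ starP Λ₀') →
      ∀ {ψ : Balaban1983to89.Site P 1 → ℂ} {φ : HiggsField P 0} {c' : ℝ}, 0 ≤ c' → c' ≤ 1 →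
      SmallField315 (pLog p e₀) lam₀ Λ Λ' (covD 1 (cfg U) φ) ψ (qCov U φ) φ (fun p => ‖fieldStrength e₀ (plaqVar (cfg U) p)‖) →
      ∀ (Λ₄s : Finset (PBond P 0)),
      SmallBlock332 (2 * (17 * (P.d : ℝ) ^ 2 * (P.L : ℝ) ^ 2)) e₀ (pLog p e₀) lam₀ Λ' (plaqVar (cfg (qU U))) ψ
        (covD c' (cfg (barU 1 (bg42 1 (w327 hd' R (P.L : ℝ) e₀ Λ₄s) (qU U)))) ψ) := by
  obtain ⟨C, hC, H⟩ := smallBlock332_u1bar_byName d L hd hL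
  obtain ⟨ē, hē, -, hreg⟩ := regimes332_of_smallCharge d L hC.le hc₀ hp
  refine ⟨ē, hē, ?_⟩
  intro P hP hPL h1 hd' R U e₀ lam₀ he heē hlam hlam1 hel Λ Λ' Λ₀' hΛ₁ hΛ₂ hΛ₃ hmargin ψ φ c' hc0 hc1 h Λ₄s
  obtain ⟨r1, r2, r3⟩ := hreg he heē hlam hel
  subst hP hPL
  exact H P rfl rfl h1 hd' R U he (pLog_nonneg _ _) hlam hlam1 r1 r2 r3 hΛ₁ hΛ₂ hΛ₃ hmargin hc0 hc1 h Λ₄s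

/-- **(3.15) ⟹ (3.32) AT r18's TYPED `u₁` WITH ALL THREE FACTORS (typing (B)), EVERY ANALYTIC INPUT DISCHARGED BY NAME, FOR SMALL CHARGE**:
gen 34's `smallBlock332_u1bgBar_byName` (u in the axial gauge `δ_{Ax}`, every `A^{(0)}` tied to `arg(u′)/e₀` by (3.27) with p29's correction
of record) with its three `e₀`-regimes REPLACED by `0 < e₀ ≤ ē(d, L, c₀, p)` and `e₀² ≤ c₀λ₀`, `p(e₀) = pLog p e₀`.
[cite: BalabanImbrieJaffe1988, (3.32) p.270] -/
theorem smallBlock332_u1bgBar_smallCharge (d L : ℕ) (hd : 2 ≤ d) (hL : 1 ≤ L) {c₀ p : ℝ} (hc₀ : 0 < c₀) (hp : 0 < p) :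
    ∃ ē : ℝ, 0 < ē ∧ ∀ (P : Params), P.d = d → P.L = L → ∀ (h1 : 1 ≤ P.m + P.K) (hd' : 2 ≤ P.d) (R : ℝ) {U : GaugeField P 0 U1},
      DeltaAx U → ∀ {e₀ lam₀ : ℝ}, 0 < e₀ → e₀ ≤ ē → 0 < lam₀ → lam₀ ≤ 1 → e₀ ^ 2 ≤ c₀ * lam₀ →
      ∀ {Λ : Finset (Balaban1983to89.Site P 0)} {Λ' Λ₀' : Finset (Balaban1983to89.Site P 1)} {Λ₁s Λ₄s Λ₆s : Finset (PBond P 0)},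
      (∀ x : Balaban1983to89.Site P 0, blockOf x ∈ Λ' → x ∈ Λ) →
      (∀ p : Balaban1983to89.Plaq P 0, blockOf p.src ∈ Λ' → p ∈ starP Λ) →
      (∀ q ∈ starP Λ₀', ∀ p : Balaban1983to89.Plaq P 0, blockOf p.src = q.src ∨ blockOf p.src = q.src.shift q.μ ∨
        blockOf p.src = q.src.shift q.ν ∨ blockOf p.src = (q.src.shift q.μ).shift q.ν → p ∈ starP Λ) →
      (∀ b ∈ Λ₁s, ∀ p : Balaban1983to89.Plaq P 0, blockOf p.src = blockOf b.src ∨ blockOf p.src = (blockOf b.src).shift b.dir →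
        p ∈ starP Λ) →
      (∀ b ∈ Λ₁s, b ∈ Λ₄s → ∀ x : Balaban1983to89.Site P 0, (supDist b.src x : ℝ) ≤ R + 4 * P.L + 1 →
        ∀ q : Balaban1983to89.Plaq P 1, q.src = blockOf x → q ∈ starP Λ₀') →
      (∀ b' ∈ starB Λ', ∀ s < P.L, (⟨LatticeFieldCalculus.runSite (embIter 1 b'.src) b'.dir s, b'.dir⟩ : PBond P 0) ∈ Λ₁s) →
      ∀ {ψ : Balaban1983to89.Site P 1 → ℂ} {φ : HiggsField P 0} {c' : ℝ}, 0 ≤ c' → c' ≤ 1 →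
      SmallField315 (pLog p e₀) lam₀ Λ Λ' (covD 1 (cfg U) φ) ψ (qCov U φ) φ (fun p => ‖fieldStrength e₀ (plaqVar (cfg U) p)‖) →
      ∀ (A0 : PBond P 0 → ℝ),
      BIJ88Sect3Translations.Aprime327 Λ₄s (P.L : ℝ) A0 (corr327 hd' R e₀ (cfg (qU U))) =
        (fun b => argB (toC (BIJ85BlockAveragesTorus.uPrime U b)) / e₀) →
      SmallBlock332 (2 * (17 * (P.d : ℝ) ^ 2 * (P.L : ℝ) ^ 2)) e₀ (pLog p e₀) lam₀ Λ' (plaqVar (cfg (qU U))) ψ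
        (covD c' (fun c : PBond P 1 => ∏ s ∈ range P.L,
          u1bg Λ₁s Λ₄s Λ₆s (cfg (qsstarG (qU U))) e₀ (P.L : ℝ) A0 (corr327 hd' R e₀ (cfg (qU U)))
            ⟨LatticeFieldCalculus.runSite (embIter 1 c.src) c.dir s, c.dir⟩) ψ) := by
  obtain ⟨C, hC, H⟩ := smallBlock332_u1bgBar_byName d L hd hL
  obtain ⟨ē, hē, -, hreg⟩ := regimes332_of_smallCharge d L hC.le hc₀ hp
  refine ⟨ē, hē, ?_⟩
  intro P hP hPL h1 hd' R U hU e₀ lam₀ he heē hlam hlam1 hel Λ Λ' Λ₀' Λ₁s Λ₄s Λ₆s hΛ₁ hΛ₂ hΛ₃ hΛ₁s hmarginB hline ψ φ c' hc0 hc1 h A0 h327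
  obtain ⟨r1, r2, r3⟩ := hreg he heē hlam hel
  subst hP hPL
  exact H P rfl rfl h1 hd' R hU he (pLog_nonneg _ _) hlam hlam1 r1 r2 r3 hΛ₁ hΛ₂ hΛ₃ hΛ₁s hmarginB hline hc0 hc1 h A0 h327

end

end Literature.MathematicalPhysics.QuantumFieldTheory.BalabanImbrieJaffe1984to88.BIJ88SmallBlockFields332SmallCharge
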